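import Summits.MatrixMultiplication.MatrixMultiplication.Theses.TetrahedronCarving
import Summits.MatrixMultiplication.MatrixMultiplication.Theorems.EdgePencilSixthLadder
import HarnessLib

/-!
# Birth skeleton (BC3) for the crux `TetraExcessZero` (item `stmt-MatrixMultiplication-26697`) of
# route `TetrahedronCarving` — line «half-edge»: the sixth-edge ladder cut at `δ = 1/2`

`TetraExcessZero : ω(K₄) ≤ ω(2,1,2)` («re-inserting the sixth edge into the diamond costs nothing»).
Along the sixth-edge family `W_n^{(⌈n^δ⌉)}` (edge `01` of bond `n^δ`, the other five of bond `n`;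
exponent `χ(δ) = EdgePencil.omegaSix ℂ δ`, kernel `EdgePencilSixthLadder`: `χ(0) = ω(2,1,2)`,
`χ(1) = ω(K₄)`, `χ` monotone, `TetraExcessZero ⟺ ∀ δ < 1, χ(δ) ≤ ω(2,1,2)`) the crux is the
flatness of `χ` on `[0,1]`; this line cuts it at the midpoint into two NECESSARY, UNDECIDED halves:

* `stub_pendantHalf : χ(1/2) ≤ ω(2,1,2)` — a pendant pair of bond `√n` laid across the diamond is
  free (the RUNG at `δ = 1/2`; by the symmetrised pricing
  `EdgePencilSixthSymmetrisationExponent.omegaTetra_le_of_sixRung_half` (proposed, lens-6 g23) it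
  alone yields `11·ω(K₄) ≤ 12·ω(2,1,2)`, numerically `ω(K₄) ≤ 4.4601` against the printed `4.633908`);
* `stub_growHalf : ω(K₄) ≤ χ(1/2)` — thickening the half edge to a full edge is free (the ladder is
  flat on `[1/2, 1]`; by `le_omegaSix_symm` the gap to close is at most `ω(K₄)/12 ≤ 1/2`).

Neither stub is a rung-range (a statement `∀ δ ∈ I, χ(δ) ≤ ω(2,1,2)` over an interval reaching up
to `1` would restate the crux by `sixRung_anti`), neither implies the crux or `ω = 2` on its own
(worlds: `χ(1/2) = ω(2,1,2) = 4 < ω(K₄) = 4.3` kills `growHalf` only; `ω(2,1,2) = 4 < χ(1/2) =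
ω(K₄) = 4.3` kills `pendantHalf` only — both consistent with every tree inequality `4 ≤ ω(2,1,2) ≤
χ(δ) ≤ ω(K₄) ≤ min (2ω, χ(δ) + 1 − δ)`), and the seam is `le_trans` (flag `trivial_seam`).
-/

set_option linter.dupNamespace false

namespace Summit.MatrixMultiplication.MatrixMultiplication.Cruxes.TetraExcessZero.Birth

open Literature.Computability.AlgebraicComplexity
open Summit.MatrixMultiplication.MatrixMultiplication.Theorems.TetrahedronTensor
open Summit.MatrixMultiplication.MatrixMultiplication.Theorems.EdgePencil
open Summit.MatrixMultiplication.MatrixMultiplication.Theses.TetrahedronCarving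

/-- **Stub 1 (the pendant half-edge is free on the diamond)**: the rung of the sixth-edge ladder at
`δ = 1/2`, `χ(1/2) ≤ ω(2,1,2)`. NEC (`sixRung_of_excessZero`); open. -/
theorem stub_pendantHalf : omegaSix ℂ (1 / 2) ≤ omegaRect ℂ 2 1 2 := by
  sorry

/-- **Stub 2 (thickening the half edge is free)**: `ω(K₄) ≤ χ(1/2)`, i.e. the ladder is flat on
`[1/2, 1]`. NEC (under the crux `χ ≡ ω(2,1,2) = ω(K₄)`); open. -/
theorem stub_growHalf : omegaTetra ℂ ≤ omegaSix ℂ (1 / 2) := by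
  sorry

/-! ## The composition: the crux BY NAME -/

/-- **THE SKELETON THEOREM** (kernel-checked seam, no `sorry` of its own): the crux
`Theses.TetrahedronCarving.TetraExcessZero` (stmt-MatrixMultiplication-26697) concluded BY NAME from the two
registered stubs, `ω(K₄) ≤ χ(1/2) ≤ ω(2,1,2)`. [folklore] -/
theorem TetraExcessZero_of : TetraExcessZero :=
  le_trans stub_growHalf stub_pendantHalf

/-- Both stubs are NECESSARY: the crux implies each (neither strengthens the target beyond the
crux). -/
theorem stubs_of_TetraExcessZero (h : TetraExcessZero) :
    (omegaSix ℂ (1 / 2) ≤ omegaRect ℂ 2 1 2) ∧ (omegaTetra ℂ ≤ omegaSix ℂ (1 / 2)) :=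
  ⟨sixRung_of_excessZero ℂ h _,
    le_trans (show omegaTetra ℂ ≤ omegaRect ℂ 2 1 2 from h) (omegaRect_two_one_two_le_omegaSix ℂ _)⟩

end Summit.MatrixMultiplication.MatrixMultiplication.Cruxes.TetraExcessZero.Birth
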